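import Summits.Ventures.PercRepro.S2LPCount
import Summits.Ventures.PercRepro.S1TriangleCount

/-!
# PercRepro — THE DIAGONAL CLASSES ARE FEW, AND THE CLASS OF TRIANGLES (p2, gen 30; the level-5 coloop/closure LP,
SUBCLAIM-S2 feeder)

The diagonal classes `nuSets s ν s` (`ν ≥ 1`: the `s`-sets of nullity `ν` that are their own core) are disjoint
subsets of the coloop-free dependent `s`-sets, so by `S2LPCount` their total is at most `C(d + s − 1, s)` when
`|E| = r(M) + d`; and the class `nuSets 3 1 3` is the set of triangles, at most `d(d + 1)/2` of them under «lines ≤ 3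
points» (Lemma T, `S1TriangleCount`). Nothing is claimed about any cell.

* `nuSets_diag_subset_cfree`, **`sum_ncard_nuSets_diag_le`**, `nuSets_three_one_three_subset_triangles`,
  **`two_mul_ncard_nuSets_three_le`**.
Axioms: standard.
-/

open scoped Matroid

namespace PercRepro

namespace S2LP

open Set Finset

variable {α : Type}

variable {M : Matroid α} [M.Finite]

/-- A diagonal class `nuSets s ν s` with `ν ≥ 1` consists of coloop-free dependent `s`-sets. -/
theorem nuSets_diag_subset_cfree {s ν : ℕ} (hν : 1 ≤ ν) (hνs : ν ≤ s) : nuSets M s ν s ⊆ cfree M s := by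
  rintro T ⟨⟨hTE, hTs, hTr⟩, hcore⟩
  have hTfin : T.Finite := M.ground_finite.subset hTE
  refine ⟨hTE, hTs, ?_, ?_⟩
  · rw [← Matroid.eRk_lt_encard_iff_dep_of_finite hTfin hTE, hTr, ← hTfin.cast_ncard_eq, hTs]
    exact_mod_cast (show s - ν < s by omega)
  · -- the core is `T` itself (its size is `s = #T`), and the core is coloop-free
    have hcoreT : core M T = T := by
      have := ncard_core_add_ncard_coloopsOf (M := M) hTE
      rw [hcore, hTs] at this
      have h0 : (coloopsOf M T).ncard = 0 := by omega
      have hC : coloopsOf M T = ∅ := (ncard_eq_zero (hTfin.subset (coloopsOf_subset T))).1 h0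
      unfold core; rw [hC, sdiff_empty]
    have := coloopsOf_core_eq_empty (M := M) hTE
    rwa [hcoreT] at this

/-- **THE DIAGONAL CLASSES ARE FEW**: `Σ_{1 ≤ ν ≤ m} #nuSets s ν s ≤ C(d + s − 1, s)` when `|E| = r(M) + d`. -/
theorem sum_ncard_nuSets_diag_le {d : ℕ} (hd : M.E.encard = M.eRank + d) (s m : ℕ) (hs : 1 ≤ s) (hm : m ≤ s) :
    ∑ ν ∈ Finset.Icc 1 m, (nuSets M s ν s).ncard ≤ (d + s - 1).choose s := by
  have hsub : (⋃ ν ∈ ((Finset.Icc 1 m : Finset ℕ) : Set ℕ), nuSets M s ν s) ⊆ cfree M s := by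
    intro T hT
    rw [mem_iUnion₂] at hT
    obtain ⟨ν, hν, hTν⟩ := hT
    rw [Finset.mem_coe, Finset.mem_Icc] at hν
    exact nuSets_diag_subset_cfree hν.1 (by omega) hTν
  have hdisj : ((Finset.Icc 1 m : Finset ℕ) : Set ℕ).PairwiseDisjoint (fun ν => nuSets M s ν s) := by
    intro ν hν ν' hν' hνν'
    rw [Function.onFun, Set.disjoint_left]
    rintro T ⟨⟨-, -, h1⟩, -⟩ ⟨⟨-, -, h2⟩, -⟩
    rw [Finset.mem_coe, Finset.mem_Icc] at hν hν'
    apply hνν'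
    have h := h1.symm.trans h2
    have h' : s - ν = s - ν' := by exact_mod_cast h
    omega
  have heq := (Finset.Icc 1 m).finite_toSet.ncard_biUnion (s := fun ν => nuSets M s ν s)
    (fun ν _ => nuSets_finite s ν s) hdisj
  rw [finsum_mem_coe_finset] at heq
  rw [← heq]
  exact (ncard_le_ncard hsub (cfree_finite M s)).trans (ncard_cfree_le_choose_of_encard M hd s hs)

/-- The class `nuSets 3 1 3` consists of triangles. -/
theorem nuSets_three_one_three_subset_triangles : nuSets M 3 1 3 ⊆ ThmN.triangles M := by
  intro T hT
  have hcf := nuSets_diag_subset_cfree (M := M) (s := 3) (ν := 1) (by norm_num) (by norm_num) hT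
  obtain ⟨hTE, hT3, hdep, hcol⟩ := hcf
  have hTfin : T.Finite := M.ground_finite.subset hTE
  refine ⟨?_, hT3⟩
  -- a dependent `3`-set of rank `2` with no coloops is a circuit: every proper subset is independent
  obtain ⟨C, hCT, hC⟩ := hdep.exists_isCircuit_subset
  by_contra hne
  have hCne : C ≠ T := fun h => hne (h ▸ hC)
  obtain ⟨x, hxT, hxC⟩ := exists_of_ssubset (ssubset_of_subset_of_ne hCT hCne)
  -- `x ∉ C ⊆ T ∖ x`, so `T ∖ x` is dependent, hence `ρ(T ∖ x) < 2 = ρ(T)`... contradiction with `x` not a coloop?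
  -- direct: `ρ(T ∖ x) ≤ ρ(T)`, `T ∖ x` dependent of size `2` has rank `≤ 1`, `T` has rank `2`: `x` is a coloop
  have hCsub : C ⊆ T \ {x} := fun y hy => ⟨hCT hy, fun h => hxC (by rw [mem_singleton_iff] at h; rw [← h]; exact hy)⟩
  have hdep' : M.Dep (T \ {x}) := hC.dep.superset hCsub (sdiff_subset.trans hTE)
  have hr := hT.1.2.2
  rw [show (3 - 1 : ℕ) = 2 by norm_num] at hr
  have hlt := (Matroid.eRk_lt_encard_iff_dep_of_finite hTfin.sdiff (sdiff_subset.trans hTE)).2 hdep'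
  rw [← hTfin.sdiff.cast_ncard_eq, ncard_sdiff_singleton_of_mem hxT, hT3] at hlt
  have hcolx : x ∈ coloopsOf M T := by
    refine ⟨hxT, ?_⟩
    rw [hr]
    have hfin : M.eRk (T \ {x}) ≠ ⊤ := ne_top_of_lt hlt
    obtain ⟨a, ha⟩ := ENat.ne_top_iff_exists.1 hfin
    rw [← ha] at hlt ⊢
    have ha2 : a < 3 - 1 := by exact_mod_cast hlt
    -- `ρ(T ∖ x) ≥ ρ(T) − 1 = 1`
    have hge : M.eRk T ≤ M.eRk (T \ {x}) + 1 := by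
      have := M.eRk_insert_le_add_one x (T \ {x})
      rwa [insert_sdiff_singleton, insert_eq_of_mem hxT] at this
    rw [hr, ← ha] at hge
    have hge' : 2 ≤ a + 1 := by exact_mod_cast hge
    have : a = 1 := by omega
    rw [this]; rfl
  rw [hcol] at hcolx
  exact notMem_empty x hcolx

/-- **LEMMA T FOR THE CLASS OF TRIANGLES**: under «lines ≤ 3 points» and `|E| = r(M) + d`,
`2·#nuSets 3 1 3 ≤ d(d + 1)`. -/
theorem two_mul_ncard_nuSets_three_le (hlines : ∀ L ⊆ M.E, M.eRk L = 2 → L.ncard ≤ 3) {d : ℕ}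
    (hd : M.E.encard = M.eRank + d) : 2 * (nuSets M 3 1 3).ncard ≤ d * (d + 1) :=
  (Nat.mul_le_mul_left 2 (ncard_le_ncard nuSets_three_one_three_subset_triangles
    (M.ground_finite.finite_subsets.subset (fun _ h => h.1.subset_ground)))).trans
    (S1.two_mul_ncard_triangles_le M hlines hd)

end S2LP

end PercRepro
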